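import Summits.ValiantsHypothesis.ValiantsHypothesis.Theorems.KPlusLogSqLawLiftingRungFourRangeGRW
import Summits.ValiantsHypothesis.ValiantsHypothesis.Theorems.KPlusLogSqLawTropicalGradedWalkChainThree

/-!
# Route «KPlusLogSqLaw», crux `Lifting` / `WeakLifting` — the `K = 4` LIFT rung for ALL `m` is exactly a QUADRATIC REAL ROW at `K = 4`

HONEST FRAMING.  Bookkeeping (no stub credit) toward the lifting cruxes of route `KPlusLogSqLaw`
(`Summit.ValiantsHypothesis.ValiantsHypothesis.Theses.KPlusLogSqLaw.Lifting`, item `stmt-ValiantsHypothesis-19772`, which implies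
`…KPlusLogSqLaw.WeakLifting`, item `stmt-ValiantsHypothesis-19561`); cell `pub-symmetroid`, seat val-sym-lift-p3 g24, 2026-08-29.  The `K = 4`
rung of the registered skeleton `Cruxes/Lifting/Lines/birth.lean` — «`TropRootLawAt m 4 n → RealRootLawAt m 4 (2^(3·4)·(n+1))` for all `m, n`» —
is a theorem for `m ≤ 24569` (`lift_rung_four_of_le_grw3`) and is the cell's open growth fork beyond.  The tree types the fork for the
whole of `Lifting` (`TropicalCensus.not_lifting_of_tropK4Law_of_realGrowth`, `…realRowFour_of_lifting_of_tropK4Law`); this file pins the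
RUNG ITSELF to one real-side statement, with explicit constants and no tropical hypothesis beyond the kernel GRW floor `2m² ≤ n`
(`TropicalCensus.grw3_le_of_tropRootLawAt_four`):

* `rung_four_of_realRowFour` — a quadratic real row `∀ m, RealRootLawAt m 4 (2^12·(m² + 1))` IMPLIES the rung for every `m` and `n`
  (sizes `m ≤ 18000`: the tree's rung; `m ≥ 2`: `2^12·(m²+1) ≤ 2^12·(n+1)` from `m² ≤ 2m² ≤ n`);
* `realRowFour_of_rung_four` — conversely the rung together with ANY all-`m` tropical row bound `B(m)` at `K = 4` gives the real row
  `∀ m, RealRootLawAt m 4 (2^12·(B(m)+1))`; with a quadratic `B` (the cell's open `TropK4Law 2`: `B(m) = c·(m+1)²`) a quadratic real row.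

So, GIVEN `TropK4Law 2`, the `K = 4` rung and «`ζ_tot(m,4) = O(m²)`» are the same statement up to the constant (`2^12` one way,
`2^12·(c+1)` the other); and WITHOUT any tropical hypothesis a real row `ζ_tot(m,4) ≤ 2^12·(m²+1)` already closes the rung.  Neither side is
claimed: a sub-Descartes real bound at fixed `K = 4` is not known (Descartes gives `2·C(m+3,3) − 1`, cubic in `m`), and `TropK4Law 2` is open.
Nothing here asserts `Lifting`, `WeakLifting`, `TropicalB`, `KPlusLogSqLaw`, `MatrixDescartes` (stmt-ValiantsHypothesis-18050) or anything about
`VP ≠ VNP`.  Def-free. [folklore] arithmetic over the cited tree lemmas.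
-/

set_option linter.dupNamespace false
set_option autoImplicit false

namespace Summit.ValiantsHypothesis.ValiantsHypothesis.Theorems.KPlusLogSqLaw

open Summit.ValiantsHypothesis.ValiantsHypothesis.Theorems.LacunarySymmetroidMatrixDescartes (RealRootLawAt)
open Summit.ValiantsHypothesis.ValiantsHypothesis.Theorems.LacunarySymmetroidMatrixDescartes.TropicalCensus (TropRootLawAt
  grw3_le_of_tropRootLawAt_four)

/-- **A quadratic real row at `K = 4` closes the `K = 4` LIFT rung for every `m`.**  If every real symmetric `4`-term lacunary pencil of
size `m` has at most `2^12·(m²+1)` distinct real zeros of its determinant (all `m`), then `TropRootLawAt m 4 n → RealRootLawAt m 4 (2^(3·4)·(n+1))`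
for all `m, n`. [folklore] -/
theorem rung_four_of_realRowFour (hreal : ∀ m : ℕ, RealRootLawAt m 4 (2 ^ 12 * (m ^ 2 + 1))) (m n : ℕ)
    (h : TropRootLawAt m 4 n) : RealRootLawAt m 4 (2 ^ (3 * 4) * (n + 1)) := by
  by_cases hm : m ≤ 18000
  · exact lift_rung_four_of_le_grw m n hm h
  · have hfloor := grw3_le_of_tropRootLawAt_four m n (by omega) h
    refine LacunarySymmetroidMatrixDescartes.Census.realRootLawAt_mono ?_ (hreal m)
    rw [show (3 * 4 : ℕ) = 12 by norm_num]
    exact Nat.mul_le_mul_left _ (by nlinarith)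

/-- **Conversely, the rung turns any all-`m` tropical row bound at `K = 4` into a real row with the same growth.**  With the cell's open
`TropK4Law 2` (`B m = c·(m+1)²`) this is a QUADRATIC real row at `K = 4`, far below Descartes' cubic `2·C(m+3,3) − 1`. [folklore] -/
theorem realRowFour_of_rung_four (B : ℕ → ℕ) (htrop : ∀ m : ℕ, TropRootLawAt m 4 (B m))
    (hrung : ∀ m n : ℕ, TropRootLawAt m 4 n → RealRootLawAt m 4 (2 ^ (3 * 4) * (n + 1))) (m : ℕ) :
    RealRootLawAt m 4 (2 ^ 12 * (B m + 1)) := by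
  have := hrung m (B m) (htrop m)
  rwa [show (3 * 4 : ℕ) = 12 by norm_num] at this

/-- **Both directions in one statement**: for any all-`m` tropical row bound `B` at `K = 4` (the kernel floor forces `2m² ≤ B m` for
`m ≥ 2`), a real row `2^12·(m²+1)` gives the `K = 4` rung, and the rung gives back the real row `2^12·(B m + 1)`. [folklore] -/
theorem rung_four_realSide (B : ℕ → ℕ) (htrop : ∀ m : ℕ, TropRootLawAt m 4 (B m)) :
    ((∀ m : ℕ, RealRootLawAt m 4 (2 ^ 12 * (m ^ 2 + 1))) →
        ∀ m n : ℕ, TropRootLawAt m 4 n → RealRootLawAt m 4 (2 ^ (3 * 4) * (n + 1))) ∧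
      ((∀ m n : ℕ, TropRootLawAt m 4 n → RealRootLawAt m 4 (2 ^ (3 * 4) * (n + 1))) →
        ∀ m : ℕ, RealRootLawAt m 4 (2 ^ 12 * (B m + 1))) :=
  ⟨fun hreal m n h => rung_four_of_realRowFour hreal m n h, fun hrung m => realRowFour_of_rung_four B htrop hrung m⟩

end Summit.ValiantsHypothesis.ValiantsHypothesis.Theorems.KPlusLogSqLaw
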